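import Summits.QuantumFields.YangMills.Theorems.ColdStartUniversalityLatticeLangevinGradientDriftFlatDrift
import Summits.QuantumFields.YangMills.Theorems.ColdStartUniversalityLatticeLangevinGeneratorCalculus
import Summits.QuantumFields.YangMills.Theorems.ColdStartUniversalityLatticeLangevinRidgeEigen
import Summits.QuantumFields.YangMills.Theorems.ColdStartUniversalityLatticeLangevinLatitudeEigen
import Mathlib.Analysis.Calculus.BumpFunction.FiniteDimension
import HarnessLib

/-!
# Route `ColdStartUniversality`, crux K_A1 `UniformColdStartMixing` (stmt-QuantumFields-24809), rung `stub_fixedCutoffMixing`: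
# G-block, assembly A2a — the `β'`-generator of a ground-state-weighted latitude eigenfunction at group points

Helper file (seat `ym-line-csu-p1`, g7).  For the SU(2) SZZ system at coupling `β'`, a group point `V`, the flat plaquette
function `ψ̂` (`ψ̂ ∘ coords = -β'·wilsonAction + const`), `φ̂ = e^{-ψ̂/2}`, and a latitude eigenfunction `F̂ = ∏_e U_{m_e} ∘ lat_g`
(eigenvalue `-λ_m` of the `β' = 0` generator), the coordinate generator at `β'` of the cut-off observable `χ·φ̂·F̂` at `coords V` equals
`φ̂ (-λ_m - V̂) F̂` with the ground-state potential `V̂ = ½ 𝓛_0 ψ̂ + ⅛ Γ(ψ̂,ψ̂)` (`generator_groundState_ridge`): the bricks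
`generator_groundState` (G1a), `driftLie_mul_entry_eq_half_sum` (G1b) and `generator_ridge_beta_zero` (G3) assembled.
No definition, no sorry.  RECORD-rung R3 plumbing; nothing here bears on the mass gap.
-/

set_option autoImplicit false

noncomputable section

namespace Summit.QuantumFields.YangMills.Theorems.ColdStartUniversality

open Finset Metric
open scoped BigOperators Topology
open Literature.MathematicalPhysics.QuantumFieldTheory Literature.Analysis.SpecialFunctions
open Literature.MathematicalPhysics.QuantumLattice (fundamentalRep fundamentalLatticeRep)

variable {L : ℕ} [NeZero L]

omit [NeZero L] in
/-- The `β'`-drift splits into the `β' = 0` drift and the gradient part `(driftLie β' Q e) Q_e`, coordinatewise. [folklore] -/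
theorem drift_reIm_split (β' : ℝ) (Q : MatrixConfig 3 L (fundamentalLatticeRep 2).N)
    (q : Edge 3 L × Fin (fundamentalLatticeRep 2).N × Fin (fundamentalLatticeRep 2).N × Bool) :
    (fun z : ℂ => if q.2.2.2 then z.im else z.re)
        ((latticeLangevinDynamics (fundamentalLatticeRep 2) β').drift Q q.1 q.2.1 q.2.2.1) =
      (fun z : ℂ => if q.2.2.2 then z.im else z.re)
          ((latticeLangevinDynamics (fundamentalLatticeRep 2) 0).drift Q q.1 q.2.1 q.2.2.1) +
        (fun z : ℂ => if q.2.2.2 then z.im else z.re)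
          (((fundamentalLatticeRep 2).driftLie β' Q q.1 * Q q.1) q.2.1 q.2.2.1) := by
  have h0 : (fundamentalLatticeRep 2).driftLie 0 Q q.1 = 0 := by
    unfold LatticeRep.driftLie; exact zero_smul ℝ _
  have hmat : (latticeLangevinDynamics (fundamentalLatticeRep 2) β').drift Q q.1 =
      (latticeLangevinDynamics (fundamentalLatticeRep 2) 0).drift Q q.1 + (fundamentalLatticeRep 2).driftLie β' Q q.1 * Q q.1 := by
    rw [latticeLangevinDynamics_drift, latticeLangevinDynamics_drift, h0, zero_add, Matrix.add_mul, add_comm]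
  have hentry := congrFun (congrFun hmat q.2.1) q.2.2.1
  rw [Matrix.add_apply] at hentry
  rw [hentry]
  cases q.2.2.2
  · simp [Complex.add_re]
  · simp [Complex.add_im]

/-- **The `β'`-generator of `χ·φ̂·F̂` at a group point** (`χ` a bump `≡ 1` near the group, `φ̂ = e^{-ψ̂/2}`, `F̂` a latitude
eigenfunction): `𝓛_{β'}(χ φ̂ F̂)(coords V) = φ̂ · (-λ_m - V̂) · F̂` at `coords V`. [folklore] -/
theorem generator_groundState_ridge (β' : ℝ) (g V : Edge 3 L → Matrix.specialUnitaryGroup (Fin 2) ℂ) (m : Edge 3 L → ℕ)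
    (χ : ContDiffBump (0 : Edge 3 L × Fin 2 × Fin 2 × Bool → ℝ)) (hχ : (2 : ℝ) ≤ χ.rIn) :
    let x : (Edge 3 L × Fin 2 × Fin 2 × Bool) → ℝ := fun q =>
      (fun z : ℂ => if q.2.2.2 then z.im else z.re)
        ((fundamentalRep (Fin 2) (V q.1) : Matrix (Fin 2) (Fin 2) ℂ) q.2.1 q.2.2.1)
    let b : (Edge 3 L × Fin 2 × Fin 2 × Bool) → ℝ := fun q =>
      (fun z : ℂ => if q.2.2.2 then z.im else z.re) ((latticeLangevinDynamics (fundamentalLatticeRep 2) β').drift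
        (matrixConfig (fundamentalRep (Fin 2)) V) q.1 q.2.1 q.2.2.1)
    let b₀ : (Edge 3 L × Fin 2 × Fin 2 × Bool) → ℝ := fun q =>
      (fun z : ℂ => if q.2.2.2 then z.im else z.re) ((latticeLangevinDynamics (fundamentalLatticeRep 2) 0).drift
        (matrixConfig (fundamentalRep (Fin 2)) V) q.1 q.2.1 q.2.2.1)
    let σ : (Edge 3 L × Fin 2 × Fin 2 × Bool) → (Edge 3 L × NoiseIdx 2) → ℝ := fun q k =>
      if k.1 = q.1 then (fun z : ℂ => if q.2.2.2 then z.im else z.re)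
        ((latticeLangevinDynamics (fundamentalLatticeRep 2) 0).noise
          (matrixConfig (fundamentalRep (Fin 2)) V) q.1 k.2 q.2.1 q.2.2.1) else 0
    let lat : ((Edge 3 L × Fin 2 × Fin 2 × Bool) → ℝ) → (Edge 3 L → ℝ) := fun y e =>
      (∑ i, ∑ j, (((fundamentalRep (Fin 2) (g e) : Matrix (Fin 2) (Fin 2) ℂ) i j).re * y (e, i, j, false) +
        ((fundamentalRep (Fin 2) (g e) : Matrix (Fin 2) (Fin 2) ℂ) i j).im * y (e, i, j, true))) / 2
    let F : ((Edge 3 L × Fin 2 × Fin 2 × Bool) → ℝ) → ℝ := fun y => ∏ e, gegenbauerSum 1 (m e) (lat y e)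
    let ψ : ((Edge 3 L × Fin 2 × Fin 2 × Bool) → ℝ) → ℝ := fun y =>
      β' * ∑ p : Plaquette 3 L, (rootedLoop (fun (e : Edge 3 L) (i j : Fin 2) =>
        ((y (e, i, j, false) : ℝ) : ℂ) + ((y (e, i, j, true) : ℝ) : ℂ) * Complex.I) (p.1, p.2.1.1) p.2.1.2 false).trace.re
    let Vpot : ℝ :=
      1 / 2 * (∑ i, fderiv ℝ ψ x (Pi.single i 1) * b₀ i +
          1 / 2 * ∑ i, ∑ j, fderiv ℝ (fun z => fderiv ℝ ψ z (Pi.single i 1)) x (Pi.single j 1) * ∑ n, σ i n * σ j n) +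
        1 / 8 * ∑ i, ∑ j, fderiv ℝ ψ x (Pi.single i 1) * fderiv ℝ ψ x (Pi.single j 1) * ∑ n, σ i n * σ j n
    let f : ((Edge 3 L × Fin 2 × Fin 2 × Bool) → ℝ) → ℝ := fun y =>
      (χ : (Edge 3 L × Fin 2 × Fin 2 × Bool → ℝ) → ℝ) y * (Real.exp (-(1 / 2 : ℝ) * ψ y) * F y)
    (∑ i, fderiv ℝ f x (Pi.single i 1) * b i +
      (1 / 2) * ∑ i, ∑ j, fderiv ℝ (fun z => fderiv ℝ f z (Pi.single i 1)) x (Pi.single j 1) * ∑ n, σ i n * σ j n) =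
    Real.exp (-(1 / 2 : ℝ) * ψ x) * ((-(∑ e, (m e : ℝ) * ((m e : ℝ) + 2) / 2)) * F x - Vpot * F x) := by
  intro x b b₀ σ lat F ψ Vpot f
  classical
  -- smoothness of the pieces
  have hψ : ContDiff ℝ 2 ψ := contDiff_psiHat (d := 3) (L := L) (N := 2) (n := 2) β'
  obtain ⟨ℓ, hℓ⟩ := latitude_eq_clm (L := L) (fun e => (fundamentalRep (Fin 2) (g e) : Matrix (Fin 2) (Fin 2) ℂ))
  have hlatℓ : lat = ⇑ℓ := by funext y e; exact (hℓ y e).symm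
  have hF : ContDiff ℝ 2 F := by
    have hΦ : ContDiff ℝ 2 (fun s : Edge 3 L → ℝ => ∏ e, gegenbauerSum 1 (m e) (s e)) :=
      contDiff_prod (fun e _ => (contDiff_gegenbauerSum 1 (m e)).comp (contDiff_apply ℝ ℝ e))
    have : F = fun y => (fun s : Edge 3 L → ℝ => ∏ e, gegenbauerSum 1 (m e) (s e)) (ℓ y) := by
      funext y; simp only [F, hlatℓ]
    rw [this]; exact hΦ.comp ℓ.contDiff
  -- the cut-off is invisible near the group
  set f₀ : ((Edge 3 L × Fin 2 × Fin 2 × Bool) → ℝ) → ℝ := fun y => Real.exp (-(1 / 2 : ℝ) * ψ y) * F y with hf₀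
  have hball : x ∈ ball (0 : (Edge 3 L × Fin 2 × Fin 2 × Bool) → ℝ) 2 := by
    rw [mem_ball, dist_zero_right]
    exact (norm_coords_le_one V).trans_lt (by norm_num)
  have hfeq : ∀ y ∈ ball (0 : (Edge 3 L × Fin 2 × Fin 2 × Bool) → ℝ) 2, f y = f₀ y := by
    intro y hy
    have h1 : (χ : ((Edge 3 L × Fin 2 × Fin 2 × Bool) → ℝ) → ℝ) y = 1 :=
      χ.one_of_mem_closedBall (by rw [mem_closedBall, dist_zero_right]; exact (le_of_lt (by simpa using hy))|>.trans hχ)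
    simp only [f, hf₀, h1, one_mul]
  have hfev : ∀ y ∈ ball (0 : (Edge 3 L × Fin 2 × Fin 2 × Bool) → ℝ) 2, f =ᶠ[𝓝 y] f₀ := fun y hy =>
    Filter.eventually_of_mem (isOpen_ball.mem_nhds hy) hfeq
  have hC1 : fderiv ℝ f x = fderiv ℝ f₀ x := (hfev x hball).fderiv_eq
  have hC2 : ∀ v, fderiv ℝ (fun z => fderiv ℝ f z v) x = fderiv ℝ (fun z => fderiv ℝ f₀ z v) x := by
    intro v
    refine Filter.EventuallyEq.fderiv_eq ?_
    filter_upwards [isOpen_ball.mem_nhds hball] with z hz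
    rw [(hfev z hz).fderiv_eq]
  simp_rw [hC1, hC2]
  -- split the drift and apply the ground-state identity
  set Q : MatrixConfig 3 L (fundamentalLatticeRep 2).N := matrixConfig (fundamentalLatticeRep 2).ρ V with hQ
  have hsplit : ∀ i : Edge 3 L × Fin 2 × Fin 2 × Bool, b i = b₀ i +
      (fun z : ℂ => if i.2.2.2 then z.im else z.re)
        (((fundamentalLatticeRep 2).driftLie β' Q i.1 * Q i.1) i.2.1 i.2.2.1) := fun i =>
    drift_reIm_split β' Q i
  simp_rw [hsplit]
  have hA : ∀ i j : Edge 3 L × Fin 2 × Fin 2 × Bool, (∑ n, σ i n * σ j n) = ∑ n, σ j n * σ i n :=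
    fun i j => Finset.sum_congr rfl fun n _ => mul_comm _ _
  have hb₁ : ∀ i : Edge 3 L × Fin 2 × Fin 2 × Bool,
      (fun z : ℂ => if i.2.2.2 then z.im else z.re)
        (((fundamentalLatticeRep 2).driftLie β' Q i.1 * Q i.1) i.2.1 i.2.2.1) =
      1 / 2 * ∑ j, (∑ n, σ i n * σ j n) * fderiv ℝ ψ x (Pi.single j 1) := fun i =>
    driftLie_mul_entry_eq_half_sum β' Q i
  rw [hf₀, generator_groundState (fun i => (Pi.single i 1 : Edge 3 L × Fin 2 × Fin 2 × Bool → ℝ)) b₀ _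
    (fun i j => ∑ n, σ i n * σ j n) hA hψ hF x hb₁]
  -- the eigenfunction identity at `β' = 0`
  have heig := generator_ridge_beta_zero (L := L) g V m
  dsimp only at heig
  rw [heig]

end Summit.QuantumFields.YangMills.Theorems.ColdStartUniversality

end
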